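import Summits.Ventures.PercRepro.S1CoreCapBridge
import Summits.Ventures.PercRepro.S2DichotomyTools

/-!
# PercRepro — THE 4-CIRCUIT-CAP SPEC WITH THE SPREAD CLAUSE, AND ITS BRIDGE (p1, gen 31; the s₄ seat; a feeder for sub-claim S2, owner p7)

`proofs/P1-S2-CORANK6.md` §4–§4b. The SPREAD case of the generated level-`5` cells (S2DichotomyTools: no set `W` with `|W| ≤ 9` and nullity `4`,
the clause `¬h4` of the corank-`6` cell) says that every set of rank `≤ 5` has nullity `≤ 3` (`S2.ncard_le_of_eRk_le_of_not_nullity`). In the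
abstract configuration of the 4-circuits through a point `e` (S1CoreCapClasses / S1CoreCapRank: the set `{e} ∪ pts(l)` of a sub-family `l` of lines
has `wsum + 1` points and rank `≤ lineRank l + 1`) this is ONE more clause on top of `FourCapSpec`:
  **every sub-family `l` with `lineRank l ≤ 4` has `wsum (unionL l) ≤ lineRank l + 3`.**
`FourCapSpecSpread cap ν Q` is `FourCapSpec cap ν Q` with that clause as an extra hypothesis (so `FourCapSpec → FourCapSpecSpread`, and the
spread instances may be SMALLER: the search `fourcap_spread3.py` reads `Q*_spread(1 … 6) = 1, 4, 5, 6, 8, 9` against `Q*(ν) = 1, 4, 5, 8, 11, 16`);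
**`ncard_fourCircuitsThrough_le_of_fourCapSpecSpread`** is the bridge: on the e-free core of nullity `d` with `¬h4`, `#4circ(e) ≤ Q` whenever
`FourCapSpecSpread capPaper d Q`. The kernel instances `FourCapSpecSpread capPaper ν Q*_spread(ν)` are NOT here (the S1-lane pattern of
P1-S4-CAPBRIDGE.md §12–§17, one module per `ν`). Axioms: standard.
-/

open scoped Matroid

namespace PercRepro

namespace S1

open Set

open FourCap

variable {α : Type}

/-- **THE SPEC WITH THE SPREAD CLAUSE**: `FourCapSpec` plus «every sub-family of rank bound `≤ 4` has cost `≤ 3`»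
(`wsum (unionL l) ≤ lineRank l + 3`), the abstract form of «every set of rank `≤ 5` has nullity `≤ 3`». -/
def FourCapSpecSpread (cap : ℕ → ℕ → ℕ) (ν Q : ℕ) : Prop :=
  ∀ (β : Type) [DecidableEq β] (w : β → ℕ) (ls : Finset (Finset β)),
    (∀ L ∈ ls, ∀ v ∈ L, w v = 1 ∨ w v = 2) →
    (∀ L ∈ ls, 3 ≤ L.card ∧ wsum w L ≤ 5) →
    (∀ L ∈ ls, ∀ L' ∈ ls, L ≠ L' → (L ∩ L').card ≤ 1) →
    (∀ l : List (Finset β), l.Nodup → (∀ L ∈ l, L ∈ ls) → wsum w (unionL l) ≤ ν + lineRank l) →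
    (∀ l : List (Finset β), l.Nodup → (∀ L ∈ l, L ∈ ls) → lineRank l ≤ 3 → (unionL l).card ≤ 9) →
    (∀ l : List (Finset β), l.Nodup → (∀ L ∈ l, L ∈ ls) → lineRank l ≤ 4 → (unionL l).card ≤ 20) →
    (∀ l : List (Finset β), l.Nodup → (∀ L ∈ l, L ∈ ls) → lineRank l ≤ 4 → wsum w (unionL l) ≤ lineRank l + 3) →
    ∑ L ∈ ls, cap L.card (fat w L) ≤ Q

/-- The plain spec implies the spread spec (the extra clause is simply not used). -/
theorem FourCapSpecSpread.of_fourCapSpec {cap : ℕ → ℕ → ℕ} {ν Q : ℕ} (h : FourCapSpec cap ν Q) :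
    FourCapSpecSpread cap ν Q :=
  fun β _ w ls h1 h2 h3 h4 h5 h6 _ => h β w ls h1 h2 h3 h4 h5 h6

/-- A larger answer inherits the spread spec. -/
theorem FourCapSpecSpread.mono_right {cap : ℕ → ℕ → ℕ} {ν Q Q' : ℕ} (hQ : Q ≤ Q') (h : FourCapSpecSpread cap ν Q) :
    FourCapSpecSpread cap ν Q' :=
  fun β _ w ls h1 h2 h3 h4 h5 h6 h7 => (h β w ls h1 h2 h3 h4 h5 h6 h7).trans hQ

/-- A pointwise smaller cap table inherits the spread spec. -/
theorem FourCapSpecSpread.mono {cap cap' : ℕ → ℕ → ℕ} (hle : ∀ k f, cap k f ≤ cap' k f) {ν Q : ℕ}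
    (h : FourCapSpecSpread cap' ν Q) : FourCapSpecSpread cap ν Q := by
  intro β _ w ls h1 h2 h3 h4 h5 h6 h7
  exact (Finset.sum_le_sum (fun L _ => hle L.card (fat w L))).trans (h β w ls h1 h2 h3 h4 h5 h6 h7)

/-- A smaller nullity inherits the spread spec (the cost clause only gets stronger). -/
theorem FourCapSpecSpread.mono_nullity {cap : ℕ → ℕ → ℕ} {ν ν' Q : ℕ} (hν : ν ≤ ν') (h : FourCapSpecSpread cap ν' Q) :
    FourCapSpecSpread cap ν Q := by
  intro β _ w ls h1 h2 h3 h4 h5 h6 h7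
  exact h β w ls h1 h2 h3 (fun l hl hmem => (h4 l hl hmem).trans (by omega)) h5 h6 h7

/-- **The spread clause for the configuration of `e`**: under `¬h4` (no set of nullity `4` on `≤ 9` points) a sub-family `l` of the lines
of the 4-circuits through `e` with `lineRank l ≤ 4` has `wsum (unionL l) ≤ lineRank l + 3` — the set `{e} ∪ pts(unionL l)` has `wsum + 1`
points and rank `≤ lineRank l + 1 ≤ 5`, so its nullity is `≤ 3` (`S2.ncard_le_of_eRk_le_of_not_nullity` at `k = 4`, `w = 9`). -/
theorem wsum_unionL_le_of_not_nullity_four (M : Matroid α) [M.Finite]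
    (hfree : ∀ e ∈ M.E, ∃ A ⊆ M.E \ {e}, e ∉ M.closure A ∧ e ∉ M.closure ((M.E \ {e}) \ A))
    (hns : ¬ ∃ W ⊆ M.E, W.ncard ≤ 9 ∧ W.encard = M.eRk W + 4)
    {e : α} (he : e ∈ M.E) (l : List (Finset (Set α))) (hl : ∀ L ∈ l, L ∈ config M e) (hlr : lineRank l ≤ 4) :
    wsum Set.ncard (unionL l) ≤ lineRank l + 3 := by
  have hcls : ∀ v ∈ unionL l, ∃ q ∈ M.E, q ≠ e ∧ v = cls M e q := fun v hv => exists_rep_of_mem_unionL hl hv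
  have hptsE : pts (unionL l) ⊆ M.E := by
    intro t ht
    obtain ⟨v, hv, htv⟩ := mem_pts.1 ht
    obtain ⟨q, _, _, rfl⟩ := hcls v hv
    exact mem_ground_of_mem_cls M htv
  have hX : insert e (pts (unionL l)) ⊆ M.E := insert_subset he hptsE
  have hr := eRk_insert_pts_unionL_le M hfree he l hl
  have h1 := S2.ncard_le_of_eRk_le_of_not_nullity M 4 9 (by norm_num) hns hX (r := lineRank l + 1) (by omega)
    (by exact_mod_cast hr)
  rw [ncard_insert_of_notMem (notMem_pts_of_classes hcls) (M.ground_finite.subset hptsE),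
    ncard_pts_eq_sum M hfree he _ hcls] at h1
  unfold wsum
  omega

open Classical in
/-- **THE BRIDGE WITH THE SPREAD CLAUSE**: on the e-free core of nullity `d` with no set of nullity `4` on `≤ 9` points, the 4-circuits
through `e` number `≤ Q` whenever `FourCapSpecSpread capPaper d Q` — the six clauses of `ncard_fourCircuitsThrough_le_of_fourCapSpec`
and the seventh, `wsum_unionL_le_of_not_nullity_four`; the fibre count through the lines is unchanged. -/
theorem ncard_fourCircuitsThrough_le_of_fourCapSpecSpread (M : Matroid α) [M.Finite]
    (hfree : ∀ e ∈ M.E, ∃ A ⊆ M.E \ {e}, e ∉ M.closure A ∧ e ∉ M.closure ((M.E \ {e}) \ A))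
    {d : ℕ} (hd : M.E.encard = M.eRank + d)
    (hns : ¬ ∃ W ⊆ M.E, W.ncard ≤ 9 ∧ W.encard = M.eRk W + 4)
    {e : α} (he : e ∈ M.E) {Q : ℕ} (hspec : FourCapSpecSpread capPaper d Q) :
    {C : Set α | M.IsCircuit C ∧ C.ncard = 4 ∧ e ∈ C}.ncard ≤ Q := by
  -- the seven clauses
  have h1 : ∀ L ∈ config M e, ∀ v ∈ L, Set.ncard v = 1 ∨ Set.ncard v = 2 := by
    intro L hL v hv
    obtain ⟨q, hqE, hqe, rfl⟩ := exists_rep_of_mem_config hL hv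
    have := ncard_cls_le_two M hfree he q
    have h2 : 0 < (cls M e q).ncard := ncard_pos (cls_finite M e q) |>.2 ⟨q, mem_cls_self M hqE hqe.symm⟩
    omega
  have h2 : ∀ L ∈ config M e, 3 ≤ L.card ∧ wsum Set.ncard L ≤ 5 := by
    intro L hL
    obtain ⟨C, ⟨hC, h4, heC⟩, rfl⟩ := mem_config.1 hL
    refine ⟨three_le_card_lineOf M hC h4 heC, ?_⟩
    have hcls : ∀ v ∈ lineOf M e C, ∃ q ∈ M.E, q ≠ e ∧ v = cls M e q := fun v hv => exists_rep_of_mem_lineOf hv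
    have hsum := ncard_pts_eq_sum M hfree he _ hcls
    rw [pts_lineOf M hC.subset_ground heC] at hsum
    have hPfin : (M.closure C).Finite := M.ground_finite.subset (M.closure_subset_ground C)
    have h6 := ThmN.ncard_le_six_of_eRk_le_three_of_free M hfree (M.closure_subset_ground C)
      (eRk_closure_fourCircuit M hC h4).le
    have := ncard_sdiff_singleton_add_one (M.mem_closure_of_mem' heC (hC.subset_ground heC)) hPfin
    unfold wsum
    omega
  have h3 : ∀ L ∈ config M e, ∀ L' ∈ config M e, L ≠ L' → (L ∩ L').card ≤ 1 :=
    fun L hL L' hL' hne => card_inter_le_one_of_config M hfree he hL hL' hne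
  have h4 : ∀ l : List (Finset (Set α)), l.Nodup → (∀ L ∈ l, L ∈ config M e) →
      wsum Set.ncard (unionL l) ≤ d + lineRank l := fun l _ hl => wsum_unionL_le M hfree hd he l hl
  have h5 : ∀ l : List (Finset (Set α)), l.Nodup → (∀ L ∈ l, L ∈ config M e) → lineRank l ≤ 3 →
      (unionL l).card ≤ 9 := fun l _ hl => (card_unionL_le_of_lineRank_le M hfree he l hl).1
  have h6 : ∀ l : List (Finset (Set α)), l.Nodup → (∀ L ∈ l, L ∈ config M e) → lineRank l ≤ 4 →
      (unionL l).card ≤ 20 := fun l _ hl => (card_unionL_le_of_lineRank_le M hfree he l hl).2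
  have h7 : ∀ l : List (Finset (Set α)), l.Nodup → (∀ L ∈ l, L ∈ config M e) → lineRank l ≤ 4 →
      wsum Set.ncard (unionL l) ≤ lineRank l + 3 :=
    fun l _ hl hlr => wsum_unionL_le_of_not_nullity_four M hfree hns he l hl hlr
  have hsum := hspec (Set α) Set.ncard (config M e) h1 h2 h3 h4 h5 h6 h7
  -- the fibre count
  have hfin := fourCircuitsThrough_finite M e
  rw [show {C : Set α | M.IsCircuit C ∧ C.ncard = 4 ∧ e ∈ C} = fourCircuitsThrough M e from rfl,
    ncard_eq_toFinset_card _ hfin, Finset.card_eq_sum_card_image (lineOf M e)]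
  refine le_trans (Finset.sum_le_sum (fun L hL => ?_)) hsum
  obtain ⟨C₀, ⟨hC₀, h4₀, heC₀⟩, rfl⟩ := mem_config.1 hL
  refine le_trans ?_ (ncard_fourCircuitsThrough_in_closure_le_capPaper M hfree he hC₀ h4₀ heC₀)
  rw [← ncard_coe_finset]
  refine ncard_le_ncard ?_ ((M.ground_finite.finite_subsets).subset (fun C hC => hC.1.subset_ground))
  intro C hC
  rw [Finset.mem_coe, Finset.mem_filter, Set.Finite.mem_toFinset] at hC
  obtain ⟨⟨hCc, hC4, heC⟩, hline⟩ := hC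
  refine ⟨hCc, hC4, heC, ?_⟩
  rw [← closure_eq_of_lineOf_eq M hCc.subset_ground hC₀.subset_ground heC heC₀ hline]
  exact M.subset_closure C hCc.subset_ground

end S1

end PercRepro
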